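import Literature.Topology.FourManifolds.SphereFamilySurgery
import Mathlib.Analysis.SpecialFunctions.SmoothTransition
import HarnessLib

/-!
# Preliminaries for the regular neighbourhood of a configuration of spheres: a smooth
# minimum, and two compactness lemmas

Topic `Literature/Topology/FourManifolds` (fact seat
`provefact-Literature.Topology.FourManifolds.Matvey-69322e0896`, rung (H4)
`Literature.Topology.FourManifolds.Matveyev1996_partOne_and_fact_of_dualSpheres` of
`CorkDecompositionMiddleLevel.lean`).  The printed proofs of the cork decomposition theorem
begin with the regular neighbourhood of the configuration of the two families of 2-spheres
in the middle level — Matveyev 1996 (arXiv:dg-ga/9505001), p. 1: *"Put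
`V₀ = Nd_N(S_* ∪ P_*)`"*; Kirby 1996 (arXiv:math/9712231), §3: the 0-, 1- and 2-handles
`H_{k,i}` carried by the spheres — that is, with the union of tubes about the `Sᵢ` and about
the `Pⱼ`, plumbed at the crossings and with the corners rounded.  In the tree such a
sub-domain is to be presented as a regular sublevel set `{g ≤ 0}` of a smooth function with
regular level `0` (`RegularLevelSplitting.lean`; the format consumed by
`Literature.Topology.FourManifolds.FramedSphereFamily.exists_common_exterior_of_isSurgery`,
`SurgeryRegularDomain.lean`), and the union of the two tube systems is rounded by taking for
`g` a *smooth minimum* of the two (modified) squared fibre-distance functions.  This file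
provides the three elementary ingredients of that construction (all proved, no definitions,
no named facts):

* `Literature.Topology.FourManifolds.exists_smoothMin` — **a smooth minimum**: for `δ > 0` a
  `C^∞` function `μ : ℝ × ℝ → ℝ` with `μ(u, v) = u` when `v - u ≥ δ`, `μ(u, v) = v` when
  `v ≤ u`, `min u v ≤ μ(u, v) ≤ max u v`, and differential `s · du + (1 - s) · dv` at every
  point (so never zero): `μ(u, v) = v - (v - u) ρ((v - u)/δ)` with Mathlib's
  `Real.smoothTransition` `ρ` (the standard rounding of the corner of `min`, cf. the corner
  smoothing of plumbings, Milnor, *Lectures on the h-cobordism theorem* (1965), §1 after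
  Thm. 1.4; Kosinski, *Differential Manifolds* (1993), VI.5);
* `Literature.Topology.FourManifolds.exists_pos_forall_le_le_mem` — on a compact space, if
  `{f ≤ 0} ∩ {g ≤ 0} ⊆ U` with `U` open and `f`, `g` continuous, then
  `{f ≤ η} ∩ {g ≤ η} ⊆ U` for some `η > 0` (points where both distance functions are small
  lie near the crossings);
* `Literature.Topology.FourManifolds.FramedSphereFamily.exists_forall_norm_le_apply_mem` —
  **thin tubes lie in any neighbourhood of the cores**: for a finite framed family `φ` and
  an open `U` containing the core spheres, `φᵢ(v, w) ∈ U` whenever `‖w‖ ≤ r`, for some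
  `r > 0` (the tube lemma over the compact `Sᵏ`).

## References

* R. Matveyev, *A decomposition of smooth simply-connected h-cobordant 4-manifolds*,
  J. Differential Geom. 44 (1996) 571–582; arXiv:dg-ga/9505001, Proof of Theorem, p. 1.
  [Matveyev1996]
* R. Kirby, *Akbulut's corks and h-cobordisms of smooth, simply connected 4-manifolds*, Turkish
  J. Math. 20 (1996) 85–93; arXiv:math/9712231, §3. [KirbyCorks1996]
* J. Milnor, *Lectures on the h-cobordism theorem*, Princeton (1965), §1 (after Thm. 1.4:
  rounding corners). [MilnorHCobordism1965]
* A. A. Kosinski, *Differential Manifolds* (1993), VI.5 (straightening the angle, plumbing).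
  [Kosinski1993]
-/

open scoped Manifold ContDiff Topology
open Set Function

noncomputable section

namespace Literature.Topology.FourManifolds

universe u v

/-! ### A smooth minimum -/

/-- **A smooth minimum.** For `δ > 0` there is a `C^∞` function `μ : ℝ × ℝ → ℝ` with
`μ(u, v) = u` whenever `v - u ≥ δ`, `μ(u, v) = v` whenever `v ≤ u`,
`min u v ≤ μ(u, v) ≤ max u v` everywhere, and whose differential at `(u, v)` is
`s · du + (1 - s) · dv` for some `s` — in particular it vanishes nowhere, so that a smooth
minimum `μ(h₁, h₂)` of two functions has gradient `s ∇h₁ + (1 - s) ∇h₂`, a combination with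
coefficients not both zero.  Construction: `μ(u, v) = v - (v - u) ρ((v - u)/δ)` with
`ρ = Real.smoothTransition` (`0` on `(-∞, 0]`, `1` on `[1, ∞)`): the usual rounding of the
corner of `{u ≤ c} ∪ {v ≤ c}` (Milnor 1965, §1: straightening corners; Kosinski 1993, VI.5).
[cite: MilnorHCobordism1965, §1 (after Thm. 1.4)] [cite: Kosinski1993, Ch. VI §5] -/
theorem exists_smoothMin {δ : ℝ} (hδ : 0 < δ) :
    ∃ μ : ℝ × ℝ → ℝ, ContDiff ℝ ∞ μ ∧
      (∀ u v : ℝ, δ ≤ v - u → μ (u, v) = u) ∧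
      (∀ u v : ℝ, v ≤ u → μ (u, v) = v) ∧
      (∀ u v : ℝ, min u v ≤ μ (u, v) ∧ μ (u, v) ≤ max u v) ∧
      ∀ u v : ℝ, ∃ s : ℝ, HasFDerivAt μ
        (s • ContinuousLinearMap.fst ℝ ℝ ℝ + (1 - s) • ContinuousLinearMap.snd ℝ ℝ ℝ) (u, v) := by
  -- the rounded positive part `q t = t ρ(t/δ)` and the function `μ (u, v) = v - q (v - u)`
  set q : ℝ → ℝ := fun t => t * Real.smoothTransition (t / δ) with hq
  have hqs : ContDiff ℝ ∞ q :=
    contDiff_id.mul (Real.smoothTransition.contDiff.comp (contDiff_id.div_const δ))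
  have hq_of_le : ∀ t, δ ≤ t → q t = t := fun t ht => by
    simp only [hq]
    rw [Real.smoothTransition.one_of_one_le ((one_le_div hδ).2 ht), mul_one]
  have hq_of_nonpos : ∀ t, t ≤ 0 → q t = 0 := fun t ht => by
    simp only [hq]
    rw [Real.smoothTransition.zero_of_nonpos (div_nonpos_of_nonpos_of_nonneg ht hδ.le), mul_zero]
  have hq_bounds : ∀ t, 0 ≤ t → 0 ≤ q t ∧ q t ≤ t := fun t ht =>
    ⟨mul_nonneg ht (Real.smoothTransition.nonneg _),
      mul_le_of_le_one_right ht (Real.smoothTransition.le_one _)⟩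
  refine ⟨fun p => p.2 - q (p.2 - p.1), contDiff_snd.sub (hqs.comp (contDiff_snd.sub contDiff_fst)),
    fun u v h => ?_, fun u v h => ?_, fun u v => ?_, fun u v => ?_⟩
  · show v - q (v - u) = u
    rw [hq_of_le _ h]
    ring
  · show v - q (v - u) = v
    rw [hq_of_nonpos _ (sub_nonpos.2 h), sub_zero]
  · show min u v ≤ v - q (v - u) ∧ v - q (v - u) ≤ max u v
    rcases le_total v u with hvu | huv
    · rw [hq_of_nonpos _ (sub_nonpos.2 hvu), sub_zero]
      exact ⟨min_le_right _ _, le_max_right _ _⟩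
    · obtain ⟨h1, h2⟩ := hq_bounds (v - u) (sub_nonneg.2 huv)
      constructor
      · calc min u v ≤ u := min_le_left _ _
          _ = v - (v - u) := by ring
          _ ≤ v - q (v - u) := by linarith
      · calc v - q (v - u) ≤ v := by linarith
          _ ≤ max u v := le_max_right _ _
  · -- the differential: `d(v - q(v - u)) = q'(v-u) du + (1 - q'(v-u)) dv`
    have hqd : HasDerivAt q (deriv q (v - u)) (v - u) :=
      ((hqs.differentiable (by simp)) _).hasDerivAt
    set s := deriv q (v - u) with hs
    have hinner : HasFDerivAt (fun p : ℝ × ℝ => p.2 - p.1)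
        (ContinuousLinearMap.snd ℝ ℝ ℝ - ContinuousLinearMap.fst ℝ ℝ ℝ) (u, v) :=
      hasFDerivAt_snd.sub hasFDerivAt_fst
    have hqd' : HasFDerivAt q (ContinuousLinearMap.smulRight (1 : ℝ →L[ℝ] ℝ) s)
        ((fun p : ℝ × ℝ => p.2 - p.1) (u, v)) := hqd.hasFDerivAt
    have hcomp : HasFDerivAt (q ∘ fun p : ℝ × ℝ => p.2 - p.1)
        ((ContinuousLinearMap.smulRight (1 : ℝ →L[ℝ] ℝ) s).comp
          (ContinuousLinearMap.snd ℝ ℝ ℝ - ContinuousLinearMap.fst ℝ ℝ ℝ)) (u, v) :=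
      hqd'.comp (u, v) hinner
    have h := hasFDerivAt_snd.sub hcomp
    refine ⟨s, h.congr_fderiv (ContinuousLinearMap.ext fun p => ?_)⟩
    simp only [sub_apply, ContinuousLinearMap.coe_snd',
      ContinuousLinearMap.coe_comp, comp_apply, ContinuousLinearMap.coe_fst',
      ContinuousLinearMap.smulRight_apply, smul_eq_mul, add_apply, smul_apply]
    simp
    ring

/-! ### Two compactness lemmas -/

/-- On a compact space, if the points where two continuous functions are both `≤ 0` lie in an
open set `U`, then so do the points where both are `≤ η`, for some `η > 0` (the continuous
function `max f g` is positive on the compact complement of `U`, hence bounded below by a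
positive constant there). [folklore] -/
theorem exists_pos_forall_le_le_mem {X : Type u} [TopologicalSpace X] [CompactSpace X]
    {f g : X → ℝ} (hf : Continuous f) (hg : Continuous g) {U : Set X} (hU : IsOpen U)
    (h0 : ∀ x, f x ≤ 0 → g x ≤ 0 → x ∈ U) :
    ∃ η : ℝ, 0 < η ∧ ∀ x, f x ≤ η → g x ≤ η → x ∈ U := by
  rcases (Uᶜ).eq_empty_or_nonempty with hK | hK
  · refine ⟨1, one_pos, fun x _ _ => ?_⟩
    by_contra hx
    have : x ∈ Uᶜ := hx
    rw [hK] at this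
    exact this
  · obtain ⟨x₀, hx₀, hmin⟩ := hU.isClosed_compl.isCompact.exists_isMinOn hK
      ((hf.max hg).continuousOn)
    have hpos : 0 < max (f x₀) (g x₀) := by
      by_contra hle
      push Not at hle
      exact hx₀ (h0 x₀ ((le_max_left _ _).trans hle) ((le_max_right _ _).trans hle))
    refine ⟨max (f x₀) (g x₀) / 2, half_pos hpos, fun x hfx hgx => ?_⟩
    by_contra hx
    have h1 : max (f x₀) (g x₀) ≤ max (f x) (g x) := hmin (show x ∈ Uᶜ from hx)
    have h2 : max (f x) (g x) ≤ max (f x₀) (g x₀) / 2 := max_le hfx hgx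
    linarith

/-! ### Extending a function by a constant off an open set -/

/-- **Extension by a constant.**  Let `U` be an open subset of a manifold `M`, `f : M → F` a
function which is `C^n` on `U`, and `K ⊆ U` a closed subset of `M` off which, inside `U`, `f`
is the constant `c`.  Then the function equal to `f` on `U` and to `c` off `U` is `C^n` on all
of `M` (it is `f` on the open set `U` and `c` on the open set `Kᶜ`, and `U ∪ Kᶜ = M`).  Used
to extend the clamped squared fibre distance of a tube, constant near the edge of the tube, to
the whole middle level. [folklore] -/
theorem contMDiff_piecewise_const_of_eqOn {EM HM : Type*} [NormedAddCommGroup EM] [NormedSpace ℝ EM]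
    [TopologicalSpace HM] {IM : ModelWithCorners ℝ EM HM} {M : Type u} [TopologicalSpace M]
    [ChartedSpace HM M] {F : Type v} [NormedAddCommGroup F] [NormedSpace ℝ F] {n' : WithTop ℕ∞}
    {f : M → F} {U K : Set M} (hU : IsOpen U) (hK : IsClosed K) (hKU : K ⊆ U)
    (hf : ContMDiffOn IM 𝓘(ℝ, F) n' f U) {c : F} (hc : ∀ z ∈ U, z ∉ K → f z = c)
    [DecidablePred (· ∈ U)] :
    ContMDiff IM 𝓘(ℝ, F) n' (fun z => if z ∈ U then f z else c) := by
  intro z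
  by_cases hzK : z ∈ K
  · -- near a point of `K ⊆ U` the function is `f`
    have hzU : z ∈ U := hKU hzK
    have hev : (fun z => if z ∈ U then f z else c) =ᶠ[𝓝 z] f := by
      filter_upwards [hU.mem_nhds hzU] with y hy
      rw [if_pos hy]
    exact ((hf z hzU).contMDiffAt (hU.mem_nhds hzU)).congr_of_eventuallyEq hev
  · -- near a point off `K` the function is the constant `c`
    have hev : (fun z => if z ∈ U then f z else c) =ᶠ[𝓝 z] fun _ => c := by
      filter_upwards [hK.isOpen_compl.mem_nhds hzK] with y hy
      by_cases hyU : y ∈ U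
      · rw [if_pos hyU, hc y hyU hy]
      · rw [if_neg hyU]
    exact contMDiffAt_const.congr_of_eventuallyEq hev

namespace FramedSphereFamily

variable {EX HX : Type*} [NormedAddCommGroup EX] [NormedSpace ℝ EX] [TopologicalSpace HX]
  {IX : ModelWithCorners ℝ EX HX} {X : Type u} [TopologicalSpace X] [ChartedSpace HX X]
  {ι : Type v} {k m : ℕ}

/-- **Thin tubes lie in any neighbourhood of the core spheres.** For a finite framed family
`φ` and an open set `U` containing all the core spheres `φᵢ(Sᵏ × 0)`, there is `r > 0` with
`φᵢ(v, w) ∈ U` whenever `‖w‖ ≤ r` (the tube lemma over the compact `Sᵏ`, for each of the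
finitely many spheres).  With `exists_rescale` / `IsSurgery.of_rescale` this lets the tubes
cut out by the surgeries be taken inside any prescribed neighbourhood of the spheres, e.g.
inside a regular neighbourhood `V₀ ⊇ S_* ∪ P_*` (Matveyev 1996, p. 1).
[cite: Matveyev1996, Proof of Theorem (arXiv p. 1)] [cite: MilnorHCobordism1965, Def. 3.11 (PDF p. 17)] -/
theorem exists_forall_norm_le_apply_mem [Finite ι] (ν : FramedSphereFamily IX X ι k m)
    {U : Set X} (hU : IsOpen U) (hc : ∀ i v, ν.sphere i v ∈ U) :
    ∃ r : ℝ, 0 < r ∧ ∀ i v w, ‖w‖ ≤ r → ν.toFun i (v, w) ∈ U := by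
  -- for each sphere, a radius from the tube lemma
  have hone : ∀ i, ∃ r : ℝ, 0 < r ∧ ∀ v w, ‖w‖ ≤ r → ν.toFun i (v, w) ∈ U := by
    intro i
    have hn : IsOpen ((ν.toFun i) ⁻¹' U) := hU.preimage (ν.continuous i)
    have hsub : (univ : Set (Metric.sphere (0 : EuclideanSpace ℝ (Fin (k + 1))) 1)) ×ˢ
        ({0} : Set (EuclideanSpace ℝ (Fin m))) ⊆ (ν.toFun i) ⁻¹' U := by
      rintro ⟨v, w⟩ ⟨-, hw⟩
      rw [mem_singleton_iff] at hw
      subst hw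
      exact hc i v
    obtain ⟨u, t, -, ht, huniv, h0t, hut⟩ :=
      generalized_tube_lemma isCompact_univ isCompact_singleton hn hsub
    have h0 : (0 : EuclideanSpace ℝ (Fin m)) ∈ t := h0t (mem_singleton _)
    obtain ⟨ε, hε, hball⟩ := Metric.isOpen_iff.1 ht 0 h0
    refine ⟨ε / 2, half_pos hε, fun v w hw => hut ⟨huniv (mem_univ v), hball ?_⟩⟩
    rw [Metric.mem_ball, dist_zero_right]
    linarith
  choose r hr hrU using hone
  rcases isEmpty_or_nonempty ι with hι | hι
  · exact ⟨1, one_pos, fun i => isEmptyElim i⟩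
  · obtain ⟨i₀, hi₀⟩ := Finite.exists_min r
    exact ⟨r i₀, hr i₀, fun i v w hw => hrU i v w (hw.trans (hi₀ i))⟩

/-- The open tube of radius `r` about the `i`-th sphere, `φᵢ(Sᵏ × B(0, r))`, is open (`φᵢ`
is an open embedding). [cite: MilnorHCobordism1965, Def. 3.9 (PDF p. 16)] -/
theorem isOpen_image_ball (ν : FramedSphereFamily IX X ι k m) (i : ι) (r : ℝ) :
    IsOpen ((ν.toFun i) '' (univ ×ˢ Metric.ball (0 : EuclideanSpace ℝ (Fin m)) r)) :=
  (Topology.IsOpenEmbedding.isOpenMap ⟨(ν.isSmoothEmbedding i).isEmbedding, ν.isOpen_range i⟩) _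
    (isOpen_univ.prod Metric.isOpen_ball)

/-- The closed tube of radius `r` about the `i`-th sphere, `φᵢ(Sᵏ × B̄(0, r))`, is compact.
[cite: MilnorHCobordism1965, Def. 3.9 (PDF p. 16)] -/
theorem isCompact_image_closedBall (ν : FramedSphereFamily IX X ι k m) (i : ι) (r : ℝ) :
    IsCompact ((ν.toFun i) '' (univ ×ˢ Metric.closedBall (0 : EuclideanSpace ℝ (Fin m)) r)) :=
  (isCompact_univ.prod (isCompact_closedBall _ _)).image (ν.continuous i)

/-- A point of the open `r`-tube is `φᵢ(v, w)` with `‖w‖ < r`. [folklore] -/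
theorem mem_image_ball_iff (ν : FramedSphereFamily IX X ι k m) (i : ι) (r : ℝ) (z : X) :
    z ∈ (ν.toFun i) '' (univ ×ˢ Metric.ball (0 : EuclideanSpace ℝ (Fin m)) r) ↔
      ∃ v w, ‖w‖ < r ∧ ν.toFun i (v, w) = z := by
  constructor
  · rintro ⟨⟨v, w⟩, ⟨-, hw⟩, rfl⟩
    exact ⟨v, w, mem_ball_zero_iff.1 hw, rfl⟩
  · rintro ⟨v, w, hw, rfl⟩
    exact ⟨(v, w), ⟨mem_univ _, mem_ball_zero_iff.2 hw⟩, rfl⟩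

end FramedSphereFamily

end Literature.Topology.FourManifolds

end
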